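import Summits.CriticalPhenomena.CardyFormulaZ2.Theorems.CardyComplexConeParafermionToSLESixFamiliesDiamondTurnCountSelect
import HarnessLib

/-!
# The three routes of an escape staircase, by name
# (line `potential-darboux-picard-diamond`, S1p `stub_boundaryDartPhase`, part 2)

Crux `ParafermionToSLESixFamilies` (stmt-CriticalPhenomena-11389), line `potential-darboux-picard-diamond`, stub
`stub_boundaryDartPhase` (S1p). S1t's `route_select` (`…DiamondTurnCountSelect.lean`) chooses, from the position of the
outer corner `p⋆` of the start edge relative to the side `k` of the boundary segment, ONE of the three routes `routeEast`,
`routeTop`, `routeBot` (`…DiamondTurnCountFrame.lean`) from the far corner of the frame box back to `p⋆`, and hides which.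
The phase comparison across the four sides needs the signed turning of the route, hence its NAME: `route_cases`
(registered) is `route_select` with the decision left to the caller — under the EAST condition (`p⋆` beyond the next side,
or beyond side `k` with the mark after the segment) the east route has the route interface of the assembly (outside vertex
classes, first step west, end vertex and last direction of the gadget, no repeated vertex, the end vertex new, the side
functional bound, and safety for every site `u` in the frame window of the trimmed segment), and likewise TOP (`p⋆` beyond
the opposite side) and BOTTOM (`p⋆` beyond the previous side, or beyond side `k` with the mark before the segment). The
tangential window of `u` is widened by `δ` (`7δ` for `6δ`), which the separation inequalities absorb, so that the interface
also serves the first darts of the WIRED arc (whose prefix base site is one lattice step off the dart).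
-/

noncomputable section

namespace Summit.CriticalPhenomena.CardyFormulaZ2.Cruxes.ParafermionToSLESixFamilies.PotentialDarbouxPicardDiamond

open Set Metric Complex
open Literature.Probability Literature.Probability.LatticeModels
open Literature.Probability.RandomPlanarGeometry

/-- **The three routes, by name** (registered helper of `stub_boundaryDartPhase`). See the module docstring. -/
theorem route_cases : ∀ (D : DobrushinDomain) (c : ℂ) (α β : ℝ), D.carrier = {z | |((z - c) * exp (-(Real.pi / 4 : ℝ) * I)).re| < α ∧ |((z - c) * exp (-(Real.pi / 4 : ℝ) * I)).im| < β} → ∀ (k : Fin 4) (sp sq : ℝ), 0 ≤ sp → sp < sq → sq ≤ dLen α β k → ∀ (δ η ε : ℝ), 0 < δ → 100 * δ ≤ η → 16 * ε ≤ η → 16 * ε ≤ gam α β k → 10 * δ ≤ gam α β k → ∀ (ι : Site 2 → ℤ), (∀ v : Site 2, meshPoint δ v ∉ D.carrier → ι v = 0) → (∀ v : Site 2, meshPoint δ v ∈ D.carrier → ι v = 1) → ∀ (K₀ : ℕ), (∀ v : Site 2, meshPoint δ v ∈ D.carrier → |xiC k v| ≤ K₀ ∧ |upC k v| ≤ K₀)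 → (∀ v : Site 2, (xiC k v = 3 * K₀ + 10 ∨ xiC k v = -(3 * K₀ + 10) ∨ upC k v = 3 * K₀ + 10 ∨ upC k v = -(3 * K₀ + 10)) → meshPoint δ v ∉ D.carrier) → ∀ (ps : Site 2), meshPoint δ ps ∉ D.carrier → ∀ (a : ℂ), a ∈ frontier D.carrier → dist (meshPoint δ ps) a ≤ ε + 3 * δ → ∀ (gds : List (Fin 4)), gds ≠ [] → (∀ v ∈ pathVerts ps gds, v = ps ∨ (meshPoint δ v ∈ D.carrier ∧ |xiC k v - xiC k ps| ≤ 1 ∧ |upC k v - upC k ps| ≤ 1)) → (pathVerts ps gds).Nodup → meshPoint δ (pathEnd ps gds) ∈ D.carrier → pathEnd ps gds ∉ pathVerts ps gds → |xiC k (pathEnd ps gds) - xiC k ps| ≤ 1 ∧ |upC k (pathEnd ps gds) - upC k ps| ≤ 1 → ∀ (Q : List (Fin 4)), ((Q = routeEast k (3 * K₀ + 10) ps gds ∧ (gam' α β k ≤ Gk k (dRot c (meshPoint δ ps)) ∨ (gam α β k ≤ Fk k (dRot c (meshPoint δ ps)) ∧ sq - gam' α β k ≤ Gk k (dRot c a))))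 ∨ (Q = routeTop k (3 * K₀ + 10) ps gds ∧ Fk k (dRot c (meshPoint δ ps)) ≤ -gam α β k) ∨ (Q = routeBot k (3 * K₀ + 10) ps gds ∧ (Gk k (dRot c (meshPoint δ ps)) ≤ -gam' α β k ∨ (gam α β k ≤ Fk k (dRot c (meshPoint δ ps)) ∧ Gk k (dRot c a) ≤ sp - gam' α β k)))) → ∃ (C : Site 2 → Prop), (∀ v : Site 2, C v → ι v = 0) ∧ (∀ vs : Site 2, xiC k vs = 3 * K₀ + 10 → upC k vs = -(3 * K₀ + 10) → ∃ Qt : List (Fin 4), Q = (k + 2) :: Qt ∧ pathEnd vs Q = pathEnd ps gds ∧ lastDir Q = lastDir gds ∧ (∀ v ∈ pathVerts vs Q, C v ∨ v ∈ pathVerts ps gds) ∧ (pathVerts vs Q).Nodup ∧ pathEnd ps gds ∉ pathVerts vs Q ∧ (∀ b ∈ pathVerts vs Q, b = vs ∨ xiC k b - upC k b ≤ 2 * (3 * K₀ + 10) - 1)) ∧ (∀ u : Site 2, gam α β k - 3 * δ ≤ Fk k (dRot c (meshPoint δ u)) → Fk k (dRot c (meshPoint δ u)) < gam α β k → sp +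 η - 7 * δ - gam' α β k ≤ Gk k (dRot c (meshPoint δ u)) → Gk k (dRot c (meshPoint δ u)) ≤ sq - η + 7 * δ - gam' α β k → meshPoint δ u ∈ D.carrier → (∀ v : Site 2, C v → SafeVertex k u (3 * K₀ + 10) ι v) ∧ (∀ v ∈ pathVerts ps gds, SafeVertex k u (3 * K₀ + 10) ι v)) := by
  intro D c α β hcar k sp sq hsp0 hspq hsqL δ η ε hδ hδη hεη hεγ hδγ ι hι0 hι1 K₀ hK₀in hK₀out ps hpsout a ha hpa
    gds hgds hgV hgnd hx1 hx2 hx3 Q hQ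
  have hcar' : D.carrier = {z | |(dRot c z).re| < α ∧ |(dRot c z).im| < β} := hcar
  rw [dLen_eq] at hsqL
  set K : ℤ := 3 * K₀ + 10 with hK
  set Fp := Fk k (dRot c (meshPoint δ ps)) with hFp
  set Gp := Gk k (dRot c (meshPoint δ ps)) with hGp
  set Fa := Fk k (dRot c a) with hFa
  set Ga := Gk k (dRot c a) with hGa
  obtain ⟨hh1, hh2⟩ := sqrt_two_div_two_mul_bounds hδ
  -- `p⋆` versus the mark
  have hρ : ‖dRot c (meshPoint δ ps) - dRot c a‖ ≤ ε + 3 * δ := by rw [← dist_eq_norm, dist_dRot]; exact hpa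
  have hρF := (abs_le.1 ((abs_Fk_sub_le k _ _).trans hρ))
  have hρG := (abs_le.1 ((abs_Gk_sub_le k _ _).trans hρ))
  obtain ⟨hFa1, hGa1, -⟩ := frame_of_mem_frontier hcar' k ha
  have hFa2 := abs_le.1 hFa1
  have hGa2 := abs_le.1 hGa1
  -- outside facts in `ι` form
  have hιp : ι ps = 0 := hι0 _ hpsout
  have hιfar : ∀ v : Site 2, (xiC k v = K ∨ xiC k v = -K ∨ upC k v = K ∨ upC k v = -K) → ι v = 0 :=
    fun v h => hι0 v (hK₀out v h)
  have hgV' : ∀ v ∈ pathVerts ps gds, v = ps ∨ (ι v = 1 ∧ |xiC k v - xiC k ps| ≤ 1 ∧ |upC k v - upC k ps| ≤ 1) := by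
    intro v hv
    rcases hgV v hv with h | ⟨h1, h2, h3⟩
    · exact Or.inl h
    · exact Or.inr ⟨hι1 v h1, h2, h3⟩
  have hιx : ι (pathEnd ps gds) = 1 := hι1 _ hx1
  -- coordinates of `p⋆`
  obtain ⟨hx0a, hx0b⟩ := hK₀in _ hx1
  have hp1 : |xiC k ps| ≤ K - 2 := by
    have := hx3.1; rw [abs_le] at this hx0a ⊢; constructor <;> omega
  have hp2 : |upC k ps| ≤ K - 2 := by
    have := hx3.2; rw [abs_le] at this hx0b ⊢; constructor <;> omega
  have hp1' : |xiC k ps| ≤ K₀ + 1 := by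
    have := hx3.1; rw [abs_le] at this hx0a ⊢; constructor <;> omega
  have hp2' : |upC k ps| ≤ K₀ + 1 := by
    have := hx3.2; rw [abs_le] at this hx0b ⊢; constructor <;> omega
  -- gadget vertices are safe as soon as the separation holds (three forms)
  have hgadget : ∀ v : Site 2, v ∈ pathVerts ps gds →
      (xiC k v = xiC k ps ∧ upC k v = upC k ps ∧ ι v = 0) ∨ (ι v = 1 ∧ |xiC k v - xiC k ps| ≤ 1 ∧ |upC k v - upC k ps| ≤ 1) := by
    intro v hv
    rcases hgV' v hv with rfl | h
    · exact Or.inl ⟨rfl, rfl, hιp⟩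
    · exact Or.inr h
  -- frame differences between `p⋆` and a site `u`
  have hdiff : ∀ u : Site 2, Fp - Fk k (dRot c (meshPoint δ u)) =
      Real.sqrt 2 / 2 * δ * ((xiC k ps - upC k ps - (xiC k u - upC k u) : ℤ) : ℝ) ∧
      Gp - Gk k (dRot c (meshPoint δ u)) = Real.sqrt 2 / 2 * δ * ((xiC k ps + upC k ps - (xiC k u + upC k u) : ℤ) : ℝ) :=
    fun u => ⟨Fk_meshPoint_sub c δ k ps u, Gk_meshPoint_sub c δ k ps u⟩
  rcases hQ with ⟨rfl, hcase⟩ | ⟨rfl, hcase⟩ | ⟨rfl, hcase⟩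
  · ---------------------------------------------------------------- EAST
    -- the spur to the right of `p⋆` is outside
    have hιsp : ∀ v : Site 2, upC k v = upC k ps → xiC k ps + 1 ≤ xiC k v → ι v = 0 := by
      intro v hv1 hv2
      apply hι0
      apply not_mem_carrier_of_frame hcar' k
      have hpos : (1 : ℝ) ≤ ((xiC k v - upC k v - (xiC k ps - upC k ps) : ℤ) : ℝ) := by exact_mod_cast (by omega)
      have hpos' : (1 : ℝ) ≤ ((xiC k v + upC k v - (xiC k ps + upC k ps) : ℤ) : ℝ) := by exact_mod_cast (by omega)
      have e1 : Fk k (dRot c (meshPoint δ v)) - Fp = Real.sqrt 2 / 2 * δ * ((xiC k v - upC k v - (xiC k ps - upC k ps) : ℤ) : ℝ) :=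
        Fk_meshPoint_sub c δ k v ps
      have e2 : Gk k (dRot c (meshPoint δ v)) - Gp = Real.sqrt 2 / 2 * δ * ((xiC k v + upC k v - (xiC k ps + upC k ps) : ℤ) : ℝ) :=
        Gk_meshPoint_sub c δ k v ps
      have m1 : Real.sqrt 2 / 2 * δ * 1 ≤ Real.sqrt 2 / 2 * δ * ((xiC k v - upC k v - (xiC k ps - upC k ps) : ℤ) : ℝ) :=
        mul_le_mul_of_nonneg_left hpos (by positivity)
      have m2 : Real.sqrt 2 / 2 * δ * 1 ≤ Real.sqrt 2 / 2 * δ * ((xiC k v + upC k v - (xiC k ps + upC k ps) : ℤ) : ℝ) :=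
        mul_le_mul_of_nonneg_left hpos' (by positivity)
      rcases hcase with hG | ⟨hF, -⟩
      · right; right; left; linarith
      · left; linarith
    obtain hdata := fun vs (h1 : xiC k vs = K) (h2 : upC k vs = -K) =>
      routeEast_data k K ι vs ps gds h1 h2 hp1 hp2 hgds hgV' hgnd hιp hιfar hιsp hιx hx2
    refine ⟨fun v => (upC k v = -K ∧ -K + 1 ≤ xiC k v ∧ xiC k v ≤ K ∧ ι v = 0) ∨
        (xiC k v = -K ∧ -K ≤ upC k v ∧ upC k v ≤ K - 1 ∧ ι v = 0) ∨ (upC k v = K ∧ -K ≤ xiC k v ∧ xiC k v ≤ K - 1 ∧ ι v = 0) ∨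
        (xiC k v = K ∧ upC k ps + 1 ≤ upC k v ∧ upC k v ≤ K ∧ ι v = 0) ∨
        (upC k v = upC k ps ∧ xiC k ps + 1 ≤ xiC k v ∧ xiC k v ≤ K ∧ ι v = 0), ?_, ?_, ?_⟩
    · rintro v (h | h | h | h | h) <;> exact h.2.2.2
    · intro vs h1 h2
      obtain ⟨Qt, hQ, hend, hlast, hmem, hnd, hnew, hreg⟩ := hdata vs h1 h2
      refine ⟨Qt, hQ, hend, hlast, fun v hv => ?_, hnd, hnew, hreg⟩
      rcases hmem v hv with h | h | h | h | h | h
      exacts [Or.inl (Or.inl h), Or.inl (Or.inr (Or.inl h)), Or.inl (Or.inr (Or.inr (Or.inl h))),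
        Or.inl (Or.inr (Or.inr (Or.inr (Or.inl h)))), Or.inl (Or.inr (Or.inr (Or.inr (Or.inr h)))), Or.inr h]
    · intro u hFu1 hFu2 hGu1 hGu2 huin
      obtain ⟨hu1, hu2⟩ := hK₀in u huin
      obtain ⟨eF, eG⟩ := hdiff u
      -- the separation `upC u + 4 ≤ upC p⋆`
      have hS : upC k u + 4 ≤ upC k ps := by
        by_contra hc
        have hc' : ((xiC k ps + upC k ps - (xiC k u + upC k u) : ℤ) : ℝ) - ((xiC k ps - upC k ps - (xiC k u - upC k u) : ℤ) : ℝ) ≤ 6 := by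
          have : (((xiC k ps + upC k ps - (xiC k u + upC k u)) - (xiC k ps - upC k ps - (xiC k u - upC k u)) : ℤ) : ℝ) ≤ 6 := by
            exact_mod_cast (by omega)
          push_cast at this ⊢; linarith
        have m : Real.sqrt 2 / 2 * δ * (((xiC k ps + upC k ps - (xiC k u + upC k u) : ℤ) : ℝ) -
            ((xiC k ps - upC k ps - (xiC k u - upC k u) : ℤ) : ℝ)) ≤ Real.sqrt 2 / 2 * δ * 6 :=
          mul_le_mul_of_nonneg_left hc' (by positivity)
        have key : (Gp - Gk k (dRot c (meshPoint δ u))) - (Fp - Fk k (dRot c (meshPoint δ u))) ≤ 6 * δ := by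
          rw [eF, eG, ← mul_sub]; nlinarith
        rcases hcase with hG | ⟨hF, hGa3⟩
        · linarith
        · linarith
      refine ⟨fun v hv => ?_, fun v hv => ?_⟩
      · exact safeVertex_of_east k K K₀ ι u ps v hK hu1 hu2 hp1' hp2' hS (Or.inl hv)
      · exact safeVertex_of_east k K K₀ ι u ps v hK hu1 hu2 hp1' hp2' hS (Or.inr (hgadget v hv))
  · ---------------------------------------------------------------- TOP
    -- the spur above `p⋆` is outside
    have hιsp : ∀ v : Site 2, xiC k v = xiC k ps → upC k ps + 1 ≤ upC k v → ι v = 0 := by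
      intro v hv1 hv2
      apply hι0
      apply not_mem_carrier_of_frame hcar' k
      have hneg : ((xiC k v - upC k v - (xiC k ps - upC k ps) : ℤ) : ℝ) ≤ -1 := by exact_mod_cast (by omega)
      have e1 : Fk k (dRot c (meshPoint δ v)) - Fp = Real.sqrt 2 / 2 * δ * ((xiC k v - upC k v - (xiC k ps - upC k ps) : ℤ) : ℝ) :=
        Fk_meshPoint_sub c δ k v ps
      have m1 : Real.sqrt 2 / 2 * δ * ((xiC k v - upC k v - (xiC k ps - upC k ps) : ℤ) : ℝ) ≤ Real.sqrt 2 / 2 * δ * (-1) :=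
        mul_le_mul_of_nonneg_left hneg (by positivity)
      right; left; linarith
    obtain hdata := fun vs (h1 : xiC k vs = K) (h2 : upC k vs = -K) =>
      routeTop_data k K ι vs ps gds h1 h2 hp1 hp2 hgds hgV' hgnd hιp hιfar hιsp hιx hx2
    refine ⟨fun v => (upC k v = -K ∧ -K + 1 ≤ xiC k v ∧ xiC k v ≤ K ∧ ι v = 0) ∨
        (xiC k v = -K ∧ -K ≤ upC k v ∧ upC k v ≤ K - 1 ∧ ι v = 0) ∨ (upC k v = K ∧ -K ≤ xiC k v ∧ xiC k v ≤ xiC k ps - 1 ∧ ι v = 0) ∨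
        (xiC k v = xiC k ps ∧ upC k ps + 1 ≤ upC k v ∧ upC k v ≤ K ∧ ι v = 0), ?_, ?_, ?_⟩
    · rintro v (h | h | h | h) <;> exact h.2.2.2
    · intro vs h1 h2
      obtain ⟨Qt, hQ, hend, hlast, hmem, hnd, hnew, hreg⟩ := hdata vs h1 h2
      refine ⟨Qt, hQ, hend, hlast, fun v hv => ?_, hnd, hnew, hreg⟩
      rcases hmem v hv with h | h | h | h | h
      exacts [Or.inl (Or.inl h), Or.inl (Or.inr (Or.inl h)), Or.inl (Or.inr (Or.inr (Or.inl h))),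
        Or.inl (Or.inr (Or.inr (Or.inr h))), Or.inr h]
    · intro u hFu1 hFu2 hGu1 hGu2 huin
      obtain ⟨hu1, hu2⟩ := hK₀in u huin
      obtain ⟨eF, eG⟩ := hdiff u
      -- the separation `N p⋆ ≤ N u - 8`
      have hS : xiC k ps - upC k ps ≤ xiC k u - upC k u - 8 := by
        by_contra hc
        have hc' : (-7 : ℝ) ≤ ((xiC k ps - upC k ps - (xiC k u - upC k u) : ℤ) : ℝ) := by exact_mod_cast (by omega)
        have m : Real.sqrt 2 / 2 * δ * (-7) ≤ Real.sqrt 2 / 2 * δ * ((xiC k ps - upC k ps - (xiC k u - upC k u) : ℤ) : ℝ) :=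
          mul_le_mul_of_nonneg_left hc' (by positivity)
        have key : -(7 * δ) ≤ Fp - Fk k (dRot c (meshPoint δ u)) := by rw [eF]; nlinarith
        linarith
      refine ⟨fun v hv => ?_, fun v hv => ?_⟩
      · exact safeVertex_of_top hK hu2 hp1' hp2' hS (Or.inl hv)
      · exact safeVertex_of_top hK hu2 hp1' hp2' hS (Or.inr (hgadget v hv))
  · ---------------------------------------------------------------- BOTTOM
    -- the spur below `p⋆` is outside
    have hιsp : ∀ v : Site 2, xiC k v = xiC k ps → upC k v ≤ upC k ps - 1 → ι v = 0 := by
      intro v hv1 hv2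
      apply hι0
      apply not_mem_carrier_of_frame hcar' k
      have hpos : (1 : ℝ) ≤ ((xiC k v - upC k v - (xiC k ps - upC k ps) : ℤ) : ℝ) := by exact_mod_cast (by omega)
      have hneg : ((xiC k v + upC k v - (xiC k ps + upC k ps) : ℤ) : ℝ) ≤ -1 := by exact_mod_cast (by omega)
      have e1 : Fk k (dRot c (meshPoint δ v)) - Fp = Real.sqrt 2 / 2 * δ * ((xiC k v - upC k v - (xiC k ps - upC k ps) : ℤ) : ℝ) :=
        Fk_meshPoint_sub c δ k v ps
      have e2 : Gk k (dRot c (meshPoint δ v)) - Gp = Real.sqrt 2 / 2 * δ * ((xiC k v + upC k v - (xiC k ps + upC k ps) : ℤ) : ℝ) :=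
        Gk_meshPoint_sub c δ k v ps
      have m1 : Real.sqrt 2 / 2 * δ * 1 ≤ Real.sqrt 2 / 2 * δ * ((xiC k v - upC k v - (xiC k ps - upC k ps) : ℤ) : ℝ) :=
        mul_le_mul_of_nonneg_left hpos (by positivity)
      have m2 : Real.sqrt 2 / 2 * δ * ((xiC k v + upC k v - (xiC k ps + upC k ps) : ℤ) : ℝ) ≤ Real.sqrt 2 / 2 * δ * (-1) :=
        mul_le_mul_of_nonneg_left hneg (by positivity)
      rcases hcase with hG | ⟨hF, -⟩
      · right; right; right; linarith
      · left; linarith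
    obtain hdata := fun vs (h1 : xiC k vs = K) (h2 : upC k vs = -K) =>
      routeBot_data k K ι vs ps gds h1 h2 hp1 hp2 hgds hgV' hgnd hιp hιfar hιsp hιx hx2
    refine ⟨fun v => (upC k v = -K ∧ xiC k ps + 1 ≤ xiC k v ∧ xiC k v ≤ K ∧ ι v = 0) ∨
        (xiC k v = xiC k ps ∧ -K ≤ upC k v ∧ upC k v ≤ upC k ps - 1 ∧ ι v = 0), ?_, ?_, ?_⟩
    · rintro v (h | h) <;> exact h.2.2.2
    · intro vs h1 h2
      obtain ⟨Qt, hQ, hend, hlast, hmem, hnd, hnew, hreg⟩ := hdata vs h1 h2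
      refine ⟨Qt, hQ, hend, hlast, fun v hv => ?_, hnd, hnew, hreg⟩
      rcases hmem v hv with h | h | h
      exacts [Or.inl (Or.inl h), Or.inl (Or.inr h), Or.inr h]
    · intro u hFu1 hFu2 hGu1 hGu2 huin
      obtain ⟨hu1, hu2⟩ := hK₀in u huin
      obtain ⟨eF, eG⟩ := hdiff u
      -- the separation `T p⋆ ≤ T u - 8`
      have hS : xiC k ps + upC k ps ≤ xiC k u + upC k u - 8 := by
        by_contra hc
        have hc' : (-7 : ℝ) ≤ ((xiC k ps + upC k ps - (xiC k u + upC k u) : ℤ) : ℝ) := by exact_mod_cast (by omega)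
        have m : Real.sqrt 2 / 2 * δ * (-7) ≤ Real.sqrt 2 / 2 * δ * ((xiC k ps + upC k ps - (xiC k u + upC k u) : ℤ) : ℝ) :=
          mul_le_mul_of_nonneg_left hc' (by positivity)
        have key : -(7 * δ) ≤ Gp - Gk k (dRot c (meshPoint δ u)) := by rw [eG]; nlinarith
        rcases hcase with hG | ⟨hF, hGa3⟩
        · linarith
        · linarith
      refine ⟨fun v hv => ?_, fun v hv => ?_⟩
      · exact safeVertex_of_bot hK hu2 hp1' hS (Or.inl hv)
      · exact safeVertex_of_bot hK hu2 hp1' hS (Or.inr (hgadget v hv))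

end Summit.CriticalPhenomena.CardyFormulaZ2.Cruxes.ParafermionToSLESixFamilies.PotentialDarbouxPicardDiamond

end
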